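import Literature.NumberTheory.Rogawski1990.EndoscopicStableTwistAutomorphism      -- ★ FILE 2 (this seat): `exists_stableTwistAut`
import Literature.MeasureTheory.Group.HaarAutomorphismInnerSquare                   -- ★ FILE 1 (this seat): `measurePreserving_of_forall_apply_apply_eq_conj`
import Literature.NumberTheory.Automorphic.LocalUnitaryGroupCongrMeasure            -- ★ instances: `(cmDatum L N H).Local v` locally compact, second countable, T₂
import HarnessLib

/-!
# The stable twist automorphism of `H_v`, II: Haar invariance and the PER-CARTAN DICHOTOMY `|Tw(T_H)| ∈ {1, 2}` uniformly along `T_H^{G-reg}`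
(Rogawski 1990, §3.5 Prop. 3.5.2 (c) p. 29; §3.6 pp. 31–32 «`𝔇(T∕F)` has order `1` or `2`»; §12.5 p. 182)

Topic `NumberTheory/Rogawski1990`; namespace `Literature.NumberTheory.Rogawski1990`.  THEOREMS ONLY (no definition, no instance, no notation, no named
fact, no `sorry`).  Cell `pub/hodgecm-mathlib`, crux H413 = stmt-HodgeConjecture-24833, ROAD «UP-TR» (holder F0P3-p02 (g23), board v2 §B) brick **(H6a′) TWIST-MAPS**,
FILE 3∕3 (hand F0P3a-p09 (g11)); consumers BY SHAPE: (H6b′) SWIF-H (LH1-p01 (g13): binders `e`, `he : MeasurePreserving e νHv νHv`, `hest`, `hereg`, `hn`) and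
(N5) CLAIM-P (holder: `hclasses`).  HONEST LABEL: count-neutral; HC_CM is proved only modulo the printed citations until rung 0 closes.

THE MATHEMATICS.  ★ FILE 2 gives ONE automorphism `e = (Ad diag(1,r), id)` of `H_v` with inner square `e ∘ e = Ad u`, `e a ∼_st a`, and the class set
`{c | a ∼_st c.out} = {⟦a⟧, ⟦e a⟧}` of every `G`-regular `a`.  This file adds:
* `e` PRESERVES EVERY TWO-SIDED HAAR MEASURE of `H_v` (★ FILE 1: an automorphism with inner square has module `1`);
* the DICHOTOMY ALONG A CARTAN SUBGROUP `T_H = Z_H(γ₀)` (`γ₀` `G`-regular): EITHER every `G`-regular `s ∈ T_H` has `e s ∼_H s` (one class in its stable class: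
  `γ₀.1` split or irreducible), OR every `G`-regular `s ∈ T_H` has `e s ≁_H s` (two classes: `γ₀.1` of eigenframe type) — the eigenframe type PROPAGATES along the
  torus in both directions (★ `normOne_frame_of_mem_centralizer`: an element commuting with a regular eigenframe-type element is diagonal in the same anisotropic
  frame, with norm-one eigenvalues), so `|Tw(T_H)| := #{⟦s⟧, ⟦e s⟧} ∈ {1, 2}` is CONSTANT on `T_H^{G-reg}` [§3.6: `|𝔇(T∕F)| ∈ {1, 2}` by type].

* **`exists_stableTwistAut_haar_dichotomy`** — FILE 2's seven clauses + the Haar clause + the per-Cartan dichotomy, for ONE `e` and ONE `u`.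

## References
* [Rogawski1990] J. D. Rogawski, *Automorphic Representations of Unitary Groups in Three Variables*, Ann. of Math. Stud. 123 (1990), §3.1 p. 19,
  §3.5 Prop. 3.5.2 (c) p. 29, §3.6 pp. 31–32, §4.3 p. 42, §12.5 p. 182.
* [WeilIntegration1965] A. Weil, *L'intégration dans les groupes topologiques et ses applications*, 2e éd., Hermann (1965), §9.
* [LabesseLanglands1979] J.-P. Labesse, R. P. Langlands, *L-indistinguishability for SL(2)*, Canad. J. Math. 31 (1979), §2.
-/

set_option autoImplicit false

noncomputable section

open NumberField IsDedekindDomain Matrix MeasureTheory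
open scoped MatrixGroups

namespace Literature.NumberTheory.Rogawski1990

open Literature.NumberTheory.Automorphic Literature.NumberTheory.Automorphic.UnitaryGroup Literature.NumberTheory.GaloisRepresentations
open Literature.AlgebraicGeometry.ShimuraVarieties (unitaryGroup mem_unitaryGroup_iff)
open Literature.MeasureTheory.Group (measurePreserving_of_forall_apply_apply_eq_conj)

section Family

variable (L : Type) [Field L] [NumberField L] [IsCMField L] (v : HeightOneSpectrum (𝓞 ↥(maximalRealSubfield L)))

/-- Commuting is symmetric: `s ∈ Z(γ)` ⇒ `γ ∈ Z(s)`. [folklore] -/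
private theorem mem_centralizer_singleton_comm {M : Type*} [Group M] {s γ : M} (h : s ∈ Subgroup.centralizer ({γ} : Set M)) :
    γ ∈ Subgroup.centralizer ({s} : Set M) := by
  rw [Subgroup.mem_centralizer_iff] at h ⊢
  intro m hm
  rw [Set.mem_singleton_iff.1 hm]
  exact (h γ (Set.mem_singleton γ)).symm

/-- **THE STABLE TWIST AUTOMORPHISM OF `H_v` WITH ITS HAAR CLAUSE AND THE PER-CARTAN DICHOTOMY.**  At a non-split place `v` there are `e : H_v ≃ₜ* H_v` and
`u ∈ H_v` with: (1) `(e a).2 = a.2`; (2) `e a ∼_st a`; (3) `e (e a) = u a u⁻¹`; (4) `e` preserves `G`-regularity; (5) `e` PRESERVES EVERY HAAR MEASURE of `H_v` that is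
also right invariant (`MeasurePreserving e ν ν`); (6) for `G`-regular `a` every stable conjugate is conjugate to `a` or `e a`, and (7) the class set is `{⟦a⟧, ⟦e a⟧}`;
(8) DICHOTOMY along every Cartan subgroup `Z_H(γ₀)` (`γ₀` `G`-regular): either ALL its `G`-regular elements `s` have `e s ∼_H s` and class set `{⟦s⟧}` (`|Tw| = 1`),
or ALL have `e s ≁_H s` and class set `{⟦s⟧, ⟦e s⟧}` with two distinct members (`|Tw| = 2`).
[cite: Rogawski1990, §3.5 Prop. 3.5.2 (c) p. 29; §3.6 pp. 31–32; §12.5 p. 182] [cite: WeilIntegration1965, §9] [cite: LabesseLanglands1979, §2] -/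
theorem exists_stableTwistAut_haar_dichotomy (w : PlacesOver L v) (hw : IsCMField.complexConj L • w.1 = w.1)
    [MeasurableSpace ((cmDatum L 2 (Matrix.of fun i j : Fin 2 => if i.val + j.val + 1 = 2 then (1 : L) else 0)).Local v × (cmDatum L 1 (Matrix.of fun i j : Fin 1 => if i.val + j.val + 1 = 1 then (1 : L) else 0)).Local v)] [BorelSpace ((cmDatum L 2 (Matrix.of fun i j : Fin 2 => if i.val + j.val + 1 = 2 then (1 : L) else 0)).Local v × (cmDatum L 1 (Matrix.of fun i j : Fin 1 => if i.val + j.val + 1 = 1 then (1 : L) else 0)).Local v)] :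
    ∃ (e : ((cmDatum L 2 (Matrix.of fun i j : Fin 2 => if i.val + j.val + 1 = 2 then (1 : L) else 0)).Local v × (cmDatum L 1 (Matrix.of fun i j : Fin 1 => if i.val + j.val + 1 = 1 then (1 : L) else 0)).Local v) ≃ₜ* ((cmDatum L 2 (Matrix.of fun i j : Fin 2 => if i.val + j.val + 1 = 2 then (1 : L) else 0)).Local v × (cmDatum L 1 (Matrix.of fun i j : Fin 1 => if i.val + j.val + 1 = 1 then (1 : L) else 0)).Local v)) (u : ((cmDatum L 2 (Matrix.of fun i j : Fin 2 => if i.val + j.val + 1 = 2 then (1 : L) else 0)).Local v × (cmDatum L 1 (Matrix.of fun i j : Fin 1 => if i.val + j.val + 1 = 1 then (1 : L) else 0)).Local v)),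
      (∀ a : ((cmDatum L 2 (Matrix.of fun i j : Fin 2 => if i.val + j.val + 1 = 2 then (1 : L) else 0)).Local v × (cmDatum L 1 (Matrix.of fun i j : Fin 1 => if i.val + j.val + 1 = 1 then (1 : L) else 0)).Local v), (e a).2 = a.2) ∧
      (∀ a : ((cmDatum L 2 (Matrix.of fun i j : Fin 2 => if i.val + j.val + 1 = 2 then (1 : L) else 0)).Local v × (cmDatum L 1 (Matrix.of fun i j : Fin 1 => if i.val + j.val + 1 = 1 then (1 : L) else 0)).Local v), IsLocalStablyConjH L v a (e a)) ∧
      (∀ a : ((cmDatum L 2 (Matrix.of fun i j : Fin 2 => if i.val + j.val + 1 = 2 then (1 : L) else 0)).Local v × (cmDatum L 1 (Matrix.of fun i j : Fin 1 => if i.val + j.val + 1 = 1 then (1 : L) else 0)).Local v), e (e a) = u * a * u⁻¹) ∧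
      (∀ a : ((cmDatum L 2 (Matrix.of fun i j : Fin 2 => if i.val + j.val + 1 = 2 then (1 : L) else 0)).Local v × (cmDatum L 1 (Matrix.of fun i j : Fin 1 => if i.val + j.val + 1 = 1 then (1 : L) else 0)).Local v), IsLocalGRegular L v (e a) ↔ IsLocalGRegular L v a) ∧
      (∀ (ν : Measure ((cmDatum L 2 (Matrix.of fun i j : Fin 2 => if i.val + j.val + 1 = 2 then (1 : L) else 0)).Local v × (cmDatum L 1 (Matrix.of fun i j : Fin 1 => if i.val + j.val + 1 = 1 then (1 : L) else 0)).Local v)) [ν.IsHaarMeasure] [ν.IsMulRightInvariant], MeasurePreserving e ν ν) ∧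
      (∀ a : ((cmDatum L 2 (Matrix.of fun i j : Fin 2 => if i.val + j.val + 1 = 2 then (1 : L) else 0)).Local v × (cmDatum L 1 (Matrix.of fun i j : Fin 1 => if i.val + j.val + 1 = 1 then (1 : L) else 0)).Local v), IsLocalGRegular L v a → ∀ k : ((cmDatum L 2 (Matrix.of fun i j : Fin 2 => if i.val + j.val + 1 = 2 then (1 : L) else 0)).Local v × (cmDatum L 1 (Matrix.of fun i j : Fin 1 => if i.val + j.val + 1 = 1 then (1 : L) else 0)).Local v), IsLocalStablyConjH L v a k → IsConj a k ∨ IsConj (e a) k) ∧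
      (∀ a : ((cmDatum L 2 (Matrix.of fun i j : Fin 2 => if i.val + j.val + 1 = 2 then (1 : L) else 0)).Local v × (cmDatum L 1 (Matrix.of fun i j : Fin 1 => if i.val + j.val + 1 = 1 then (1 : L) else 0)).Local v), IsLocalGRegular L v a →
        {c : ConjClasses ((cmDatum L 2 (Matrix.of fun i j : Fin 2 => if i.val + j.val + 1 = 2 then (1 : L) else 0)).Local v × (cmDatum L 1 (Matrix.of fun i j : Fin 1 => if i.val + j.val + 1 = 1 then (1 : L) else 0)).Local v) | IsLocalStablyConjH L v a (Quotient.out c)} = {ConjClasses.mk a, ConjClasses.mk (e a)}) ∧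
      ∀ γ₀ : ((cmDatum L 2 (Matrix.of fun i j : Fin 2 => if i.val + j.val + 1 = 2 then (1 : L) else 0)).Local v × (cmDatum L 1 (Matrix.of fun i j : Fin 1 => if i.val + j.val + 1 = 1 then (1 : L) else 0)).Local v), IsLocalGRegular L v γ₀ →
        (∀ s ∈ Subgroup.centralizer ({γ₀} : Set ((cmDatum L 2 (Matrix.of fun i j : Fin 2 => if i.val + j.val + 1 = 2 then (1 : L) else 0)).Local v × (cmDatum L 1 (Matrix.of fun i j : Fin 1 => if i.val + j.val + 1 = 1 then (1 : L) else 0)).Local v)), IsLocalGRegular L v s →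
            IsConj s (e s) ∧ {c : ConjClasses ((cmDatum L 2 (Matrix.of fun i j : Fin 2 => if i.val + j.val + 1 = 2 then (1 : L) else 0)).Local v × (cmDatum L 1 (Matrix.of fun i j : Fin 1 => if i.val + j.val + 1 = 1 then (1 : L) else 0)).Local v) | IsLocalStablyConjH L v s (Quotient.out c)} = {ConjClasses.mk s}) ∨
        (∀ s ∈ Subgroup.centralizer ({γ₀} : Set ((cmDatum L 2 (Matrix.of fun i j : Fin 2 => if i.val + j.val + 1 = 2 then (1 : L) else 0)).Local v × (cmDatum L 1 (Matrix.of fun i j : Fin 1 => if i.val + j.val + 1 = 1 then (1 : L) else 0)).Local v)), IsLocalGRegular L v s →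
            ¬ IsConj s (e s) ∧ {c : ConjClasses ((cmDatum L 2 (Matrix.of fun i j : Fin 2 => if i.val + j.val + 1 = 2 then (1 : L) else 0)).Local v × (cmDatum L 1 (Matrix.of fun i j : Fin 1 => if i.val + j.val + 1 = 1 then (1 : L) else 0)).Local v) | IsLocalStablyConjH L v s (Quotient.out c)} = {ConjClasses.mk s, ConjClasses.mk (e s)}) := by
  classical
  obtain ⟨e, u, h1, h2, h3, h4, h5, h6, h7⟩ := exists_stableTwistAut L v w hw
  refine ⟨e, u, h1, h2, h3, h4, fun ν _ _ => measurePreserving_of_forall_apply_apply_eq_conj e ν h3, h6, h7, fun γ₀ hγ₀ => ?_⟩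
  have hγreg : IsRegularElt (γ₀.1.val : GL (Fin 2) (LocalRing L v)) := (isRegularElt_fst_snd_of_isLocalGRegular L v γ₀ hγ₀).1
  by_cases hef : ∃ (P : GL (Fin 2) (LocalRing L v)) (d : Fin 2 → (LocalRing L v)),
      (γ₀.1.val.val : Matrix (Fin 2) (Fin 2) (LocalRing L v)) * P.val = P.val * Matrix.diagonal d ∧ ∀ i, (conjLocal L (IsCMField.complexConj L) v) (d i) * d i = 1
  · -- eigenframe type: two classes all along the torus
    obtain ⟨P, d, hP, hd1⟩ := hef
    refine Or.inr fun s hs hsreg => ?_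
    have hsreg1 : IsRegularElt (s.1.val : GL (Fin 2) (LocalRing L v)) := (isRegularElt_fst_snd_of_isLocalGRegular L v s hsreg).1
    obtain ⟨hn1, hPs⟩ := normOne_frame_of_mem_centralizer L v w hw γ₀ P d hγreg hP hd1 s hs
    exact ⟨h5 s P _ hsreg1 hPs hn1, h7 s hsreg⟩
  · -- split or irreducible type: one class all along the torus
    refine Or.inl fun s hs hsreg => ?_
    have hsreg1 : IsRegularElt (s.1.val : GL (Fin 2) (LocalRing L v)) := (isRegularElt_fst_snd_of_isLocalGRegular L v s hsreg).1
    have hsep : (s.1.val : GL (Fin 2) (LocalRing L v)).val.charpoly.Separable := hsreg1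
    have hconj : IsConj s (e s) := by
      rcases eigenframe_trichotomy_of_separable L v w hw (isUnit_det_adelicForm_antidiagTwo_local L v) s.1.2 hsep with
        ⟨P, d, hP, -, hd1⟩ | ⟨P, d, hP, -, h0⟩ | hroot
      · -- `s` of eigenframe type would force `γ₀` of eigenframe type
        obtain ⟨hn1, hPγ⟩ := normOne_frame_of_mem_centralizer L v w hw s P d hsreg1 hP hd1 γ₀ (mem_centralizer_singleton_comm hs)
        exact absurd ⟨P, _, hPγ, hn1⟩ hef
      · exact isConj_of_isLocalStablyConjH_of_split L v w hw s hP h0 (e s) (h2 s)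
      · exact isConj_of_isLocalStablyConjH_of_not_exists_isRoot L v w hw s hroot (e s) (h2 s)
    refine ⟨hconj, ?_⟩
    rw [h7 s hsreg, (ConjClasses.mk_eq_mk_iff_isConj.2 hconj).symm, Set.pair_eq_singleton]

end Family

end Literature.NumberTheory.Rogawski1990

end
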